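import Literature.MathematicalPhysics.QuantumFieldTheory.Balaban1983to89.T4BetaFlowWellPosed

/-!
# EriceRemainderEnclosureHistoryAutonomyOrderWitness — (E48d) ORDER FAILS WHERE UNIQUENESS FAILS: for node U2's bump functional `bumpB u = 2 + tent(u₀)`
# (floor `b = 2`, zeroth moment `M = 20`, box ]0,1], ratio `M·γ∕b = 10 > 3√3`; two box solutions `hSlow`, `hFast` from the pin `1`, `T4BetaFlowWellPosed` §7) the
# SMALLER pin `9∕10` has the box solution `m ↦ (100∕81 + 2m)^{−1∕2}` whose first ultraviolet value `9∕√262 > 1∕2 = hFast 1` lies ABOVE the fast solution from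
# the LARGER pin `1` — two trajectories of one flow CROSS between scale `0` and scale `1`; so the uniqueness hypothesis of (E48a) `…HistoryAutonomyOrder.lt_of_pin_lt`
# cannot be dropped, and the ORDER threshold of the AUTONOMY row coincides with its uniqueness threshold on the known witnesses

Cell `pub-balaban`, β-function sub-cell, BINDER row D4 «RemainderConst leaves for Bałaban's split» (`HOME/BINDER-OWNERS.md`; owner lineage `b2b-balaban-beta-an4`;
this file by co-owner #2 lineage `b2b-balaban-beta-d4-p2`, generation 45), β-FLOW TEAM duty (1), FREEZE (0) honoured (def-free; node U2's `MemFlow` ∕ `SeqBox` and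
`T4BetaFlowWellPosed.Sharpness` — `tent`, `bumpB`, `hSlow`, `hFast`, `tent_eq_zero_of_le∕ge`, `abs_tent_sub_tent_le`, `le_bumpB`, `one_div_sqrt_le`, `le_one_div_sqrt`,
`one_div_one_div_sqrt_sq`, `hFast_one`, `le_hSlow_one`, `seqBox_hFast`, `memFlow_hFast` — BY NAME, nothing restated; the new history is an explicit lambda, no notation).
Companion of (E48a) `…HistoryAutonomyOrder` (order ⟸ uniqueness); imports node U2's `T4BetaFlowWellPosed` only (long built) — independent of (E48a) on purpose.

HONEST FRAMING (page 1, verbatim and binding).  *"Discharging BetaPertH makes Bałaban's UV stability UNCONDITIONAL — a real constructive-QFT result; it is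
NOT the continuum limit and NOT the Clay problem."*  THIS FILE DISCHARGES NOTHING OF THE KIND.  An explicit toy functional and three explicit sequences of
real numbers; nothing of Bałaban's (1.22) or its limit functional is asserted; on which side of the threshold that functional sits is NOT PRINTED (GAPS
G-t4-U2-1∕-2).  Row D4 class UNCHANGED (critical-path width 0; instance 0∕1; D4 DISCHARGE NO DATE).  HONEST DEPENDENCY: continuum YM on T⁴ ⇐ BetaPertH ∧
nine spine estimates (0/9 proved); BetaPertH ⇐ (D1) ∧ (D4) ∧ CAP+tail; G-an2-4 gates asym, D1 and NE2/3/4.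

THE POINT (census sense (α); the AUTONOMY row — its ORDER threshold from above).  (E48a): at most one box solution per pin ⟹ the solution is strictly
increasing in the pin at every scale.  Here: node U2's Markov bump (ratio `10`, where (E38c) ∕ node U2 §7 already exhibit TWO box solutions from the pin `1`:
`hSlow 1 = 1∕√3`, `hFast 1 = 1∕2` — the fast branch runs through the tent's peak at its first ultraviolet step) admits from the smaller pin `9∕10` the SLOW
history `k m = (100∕81 + 2m)^{−1∕2}`: it never touches the tent (`k 1 = 9∕√262 ≥ 11∕20`, `k (m+2) ≤ 9∕20`), so `bumpB = 2` along it and `1∕k(m+1)² = 1∕k(m)² + 2`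
(§1).  Hence (§2) `hFast 1 = 1∕2 < 11∕20 ≤ k 1` although `k 0 = 9∕10 < 1 = hFast 0`: the trajectories CROSS (`exists_crossing`), and the order statement of
(E48a) with the uniqueness hypothesis deleted is FALSE (`order_false_without_uniqueness`).  The picture at scale `1`: `hFast 1 < k 1 < hSlow 1` — the solution
set from the larger pin STRADDLES the solution from the smaller one (`straddle`).  NOT claimed: that order fails for EVERY non-unique flow; the exact order
threshold (bracket: `≥ 3√3` by (E48a)+(E38a), `≤ 10` here — (E38c)'s tent family gives every ratio above `3√3` by the same reading, not formalised here).

WHAT IS PROVED ([folklore]; 0 `def`, 0 sorry).  §1 `slow_zero`, `slow_pos`, `slow_le_one`, `seqBox_slow`, `le_slow_one`, `slow_le`, `tent_slow_succ`, **`memFlow_slow`**,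
`zerothMoment_bumpB`, `floor_bumpB`.  §2 **`hFast_one_lt_slow_one`**, `slow_one_lt_hSlow_one`, **`straddle`**, **`exists_crossing`**, **`order_false_without_uniqueness`**.
-/

noncomputable section
open Filter Topology Finset Set

namespace Summit.QuantumFields.BalabanUV.Beta.EriceRemainderEnclosureHistoryAutonomyOrderWitness

open Literature.MathematicalPhysics.QuantumFieldTheory.Balaban1983to89
open Literature.MathematicalPhysics.QuantumFieldTheory.Balaban1983to89.T4BetaStationary
open Literature.MathematicalPhysics.QuantumFieldTheory.Balaban1983to89.T4BetaFlowWellPosed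
open Literature.MathematicalPhysics.QuantumFieldTheory.Balaban1983to89.T4BetaFlowWellPosed.Sharpness

/-! ## §1 The slow history from the pin `9∕10` is a box solution of the bump flow -/

/-- The recursion variable `100∕81 + 2m` of the slow history is positive. [folklore] -/
theorem slow_base_pos (m : ℕ) : (0 : ℝ) < (10 / 9) ^ 2 + 2 * (m : ℝ) := by positivity

/-- The slow history starts at the pin `9∕10`. [folklore] -/
theorem slow_zero : (fun m : ℕ => 1 / Real.sqrt ((10 / 9) ^ 2 + 2 * (m : ℝ))) 0 = 9 / 10 := by
  simp only [Nat.cast_zero, mul_zero, add_zero]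
  rw [Real.sqrt_sq (by norm_num)]; norm_num

/-- The slow history is positive … [folklore] -/
theorem slow_pos (m : ℕ) : 0 < (fun m : ℕ => 1 / Real.sqrt ((10 / 9) ^ 2 + 2 * (m : ℝ))) m :=
  one_div_sqrt_pos (slow_base_pos m)

/-- … and at most `1`. [folklore] -/
theorem slow_le_one (m : ℕ) : (fun m : ℕ => 1 / Real.sqrt ((10 / 9) ^ 2 + 2 * (m : ℝ))) m ≤ 1 :=
  one_div_sqrt_le_one (by have : (0 : ℝ) ≤ m := Nat.cast_nonneg m; nlinarith)

/-- The slow history lies in the box ]0,1]. [folklore] -/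
theorem seqBox_slow : SeqBox 1 (fun m : ℕ => 1 / Real.sqrt ((10 / 9) ^ 2 + 2 * (m : ℝ))) := fun m =>
  ⟨slow_pos m, slow_le_one m⟩

/-- At the first ultraviolet step the slow history is ABOVE the tent: `11∕20 ≤ 9∕√262` (`262∕81 ≤ 400∕121`). [folklore] -/
theorem le_slow_one : 11 / 20 ≤ (fun m : ℕ => 1 / Real.sqrt ((10 / 9) ^ 2 + 2 * (m : ℝ))) 1 :=
  le_one_div_sqrt (slow_base_pos 1) (by norm_num)

/-- From the second ultraviolet step on it is BELOW the tent: `(100∕81 + 2(m+2))^{−1∕2} ≤ 9∕20`. [folklore] -/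
theorem slow_le (m : ℕ) : (fun m : ℕ => 1 / Real.sqrt ((10 / 9) ^ 2 + 2 * (m : ℝ))) (m + 2) ≤ 9 / 20 :=
  one_div_sqrt_le (by push_cast; have : (0 : ℝ) ≤ m := Nat.cast_nonneg m; nlinarith)

/-- So the tent is never touched beyond the pin: `tent (k (m+1)) = 0`. [folklore] -/
theorem tent_slow_succ : ∀ m : ℕ, tent ((fun m : ℕ => 1 / Real.sqrt ((10 / 9) ^ 2 + 2 * (m : ℝ))) (m + 1)) = 0
  | 0 => tent_eq_zero_of_ge le_slow_one
  | m + 1 => tent_eq_zero_of_le (slow_le m)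

/-- **THE SLOW HISTORY FROM `9∕10` SOLVES THE BUMP FLOW**: `1∕k(m+1)² = 100∕81 + 2(m+1) = 1∕k(m)² + 2 = 1∕k(m)² + bumpB(k(m+1), …)`. [folklore] -/
theorem memFlow_slow : MemFlow bumpB (9 / 10) (fun m : ℕ => 1 / Real.sqrt ((10 / 9) ^ 2 + 2 * (m : ℝ))) := by
  refine ⟨slow_zero, fun m => ?_⟩
  have hB : bumpB (fun j => (fun m : ℕ => 1 / Real.sqrt ((10 / 9) ^ 2 + 2 * (m : ℝ))) (m + 1 + j)) = 2 := by
    have h0 := tent_slow_succ m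
    simp only at h0
    simp only [bumpB, add_zero, h0]
  rw [hB]
  simp only
  rw [one_div_one_div_sqrt_sq (slow_base_pos _).le, one_div_one_div_sqrt_sq (slow_base_pos _).le]
  push_cast; ring

/-- The bump functional has the ZEROTH MOMENT `20` on every box (it is `20`-Lipschitz in the newest coupling, Markov). [folklore] -/
theorem zerothMoment_bumpB {γ : ℝ} : ∀ u u' : ℕ → ℝ, SeqBox γ u → SeqBox γ u' → ∀ D : ℝ, (∀ j, |u j - u' j| ≤ D) →
    |bumpB u - bumpB u'| ≤ 20 * D := by
  intro u u' _ _ D hD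
  calc |bumpB u - bumpB u'| = |tent (u 0) - tent (u' 0)| := by
        unfold bumpB; rw [show 2 + tent (u 0) - (2 + tent (u' 0)) = tent (u 0) - tent (u' 0) by ring]
    _ ≤ 20 * |u 0 - u' 0| := abs_tent_sub_tent_le _ _
    _ ≤ 20 * D := mul_le_mul_of_nonneg_left (hD 0) (by norm_num)

/-- The bump functional has the FLOOR `2` on every box. [folklore] -/
theorem floor_bumpB {γ : ℝ} : ∀ u : ℕ → ℝ, SeqBox γ u → 2 ≤ bumpB u := fun u _ => le_bumpB u

/-! ## §2 The crossing: pin `9∕10 < 1`, but `hFast 1 < k 1` -/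

/-- **THE CROSSING AT SCALE ONE**: `hFast 1 = 1∕2 < 11∕20 ≤ k 1` — the solution from the SMALLER pin is ABOVE the fast solution from the LARGER pin. [folklore] -/
theorem hFast_one_lt_slow_one : hFast 1 < (fun m : ℕ => 1 / Real.sqrt ((10 / 9) ^ 2 + 2 * (m : ℝ))) 1 := by
  rw [hFast_one]
  exact lt_of_lt_of_le (by norm_num) le_slow_one

/-- … while it stays below the slow solution from the larger pin: `k 1 < hSlow 1 = 1∕√3` (`3 < 262∕81`). [folklore] -/
theorem slow_one_lt_hSlow_one : (fun m : ℕ => 1 / Real.sqrt ((10 / 9) ^ 2 + 2 * (m : ℝ))) 1 < hSlow 1 := by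
  simp only [hSlow, ySlow, Nat.cast_one, mul_one]
  exact one_div_lt_one_div_of_lt (Real.sqrt_pos.2 (by norm_num)) (Real.sqrt_lt_sqrt (by norm_num) (by norm_num))

/-- **THE STRADDLE**: at scale `1` the two box solutions from the pin `1` lie on EITHER side of the solution from the pin `9∕10`:
`hFast 1 < k 1 < hSlow 1`. [folklore] -/
theorem straddle : hFast 1 < (fun m : ℕ => 1 / Real.sqrt ((10 / 9) ^ 2 + 2 * (m : ℝ))) 1 ∧
    (fun m : ℕ => 1 / Real.sqrt ((10 / 9) ^ 2 + 2 * (m : ℝ))) 1 < hSlow 1 :=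
  ⟨hFast_one_lt_slow_one, slow_one_lt_hSlow_one⟩

/-- **TWO TRAJECTORIES OF ONE FLOW THAT CROSS** — a functional with zeroth moment `M = 20` and floor `b = 2` on ]0,1] (ratio `10 > 3√3`), pins `9∕10 < 1`,
box solutions `h` from `9∕10` and `h′` from `1` with `h′ 1 < h 1`. [folklore] -/
theorem exists_crossing : ∃ (B : (ℕ → ℝ) → ℝ) (M b γ t t' : ℝ) (h h' : ℕ → ℝ),
    (∀ u u' : ℕ → ℝ, SeqBox γ u → SeqBox γ u' → ∀ D : ℝ, (∀ j, |u j - u' j| ≤ D) → |B u - B u'| ≤ M * D) ∧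
    0 ≤ M ∧ 0 < b ∧ (∀ u, SeqBox γ u → b ≤ B u) ∧ 0 < t ∧ t < t' ∧ t' ≤ γ ∧
    SeqBox γ h ∧ SeqBox γ h' ∧ MemFlow B t h ∧ MemFlow B t' h' ∧ h' 1 < h 1 :=
  ⟨bumpB, 20, 2, 1, 9 / 10, 1, fun m : ℕ => 1 / Real.sqrt ((10 / 9) ^ 2 + 2 * (m : ℝ)), hFast,
    zerothMoment_bumpB, by norm_num, by norm_num, floor_bumpB, by norm_num, by norm_num, le_rfl,
    seqBox_slow, seqBox_hFast, memFlow_slow, memFlow_hFast, hFast_one_lt_slow_one⟩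

/-- **THE UNIQUENESS HYPOTHESIS OF (E48a) `lt_of_pin_lt` CANNOT BE DROPPED**: it is FALSE that for every functional with a zeroth moment and a floor on ]0,γ]
the box solutions are increasing in the pin. [folklore] -/
theorem order_false_without_uniqueness : ¬ ∀ (B : (ℕ → ℝ) → ℝ) (M b γ t t' : ℝ) (h h' : ℕ → ℝ),
    (∀ u u' : ℕ → ℝ, SeqBox γ u → SeqBox γ u' → ∀ D : ℝ, (∀ j, |u j - u' j| ≤ D) → |B u - B u'| ≤ M * D) →
    0 ≤ M → 0 < b → (∀ u, SeqBox γ u → b ≤ B u) → 0 < t → t < t' → t' ≤ γ →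
    SeqBox γ h → SeqBox γ h' → MemFlow B t h → MemFlow B t' h' → ∀ j, h j < h' j := by
  intro H
  obtain ⟨B, M, b, γ, t, t', h, h', hB, hM, hb, hlo, ht, htt', ht'γ, hh, hh', hf, hf', hcross⟩ := exists_crossing
  exact (lt_irrefl _) ((H B M b γ t t' h h' hB hM hb hlo ht htt' ht'γ hh hh' hf hf' 1).trans hcross)

end Summit.QuantumFields.BalabanUV.Beta.EriceRemainderEnclosureHistoryAutonomyOrderWitness

end
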